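import Mathlib
import HarnessLib

/-!
# Route `DepthWindow` — the Bhargav–Dutta–Saxena sequences (PLAN-w2, file F1)

Helper file of the route `Theses/DepthWindow.lean` (decomp-valiant workshop, lens 4, generation 10): the number
theory behind the port of [BhargavDuttaSaxena2024, Thm 1.2 / Lemma 4.3] («a product-depth `Δ` circuit for
`IMM_{n,d}` has size `n^{Ω(λ/Δ)}` whenever `λ^{G(Δ)} ≤ d`, `G(Δ) = F_{Δ+2} - 1`») towards the support item
`HomImmHardSubReach` (slopes `σ ≤ 7/5`).  BDS replace the LST word (letters `⌊k/√2⌋`, `-k`) by a word with letters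
`α k` and `-k`, `1 - α = p₀/q₀ ∈ [1/(2λ), 1/λ]`, where `p₀, q₀` come from integer sequences with FIBONACCI exponents,
designed so that at every level of the depth induction the positive/negative imbalance of a low-degree sub-word is
linear in its degree ([BhargavDuttaSaxena2024, §4.1, §4.3]; conference version MFCS 2022, LIPIcs 241:18, App. A).

The file is Mathlib-only, free of circuits and words, and DEFINITION-FREE: the sequences are arbitrary functions
`r b A P : ℕ → ℕ` subject to the recursions of the source as hypotheses —
`r_m + 1 = λ^{F_{m+1}}`; denominators `b_0 = 1, b_1 = λ, b_{m+2} = r_{m+1} b_{m+1} + b_m`; quotients `P_0 = 0, P_1 = 1`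
(same recursion); and, for the top index `N = Δ - 2`, the numerators read downward, `A i = |c_{N+1-i}|`:
`A 0 = A 1 = 1`, `A (i+2) = r_{N-i} A (i+1) + A i` (i.e. `|c_m| = r_{m+1}|c_{m+1}| + |c_{m+2}|`, `|c_N| = 1`, `|c_{N+1}| := 1`);
`p₀ = c_0 = A (N+1)` and `q₀ = λ c_0 + |c_1| = b_{N+1} + b_N` — and `exists_rec_seq` provides the solutions.  Contents:

* `fib_succ_succ_mul_pow_le`, `fib_succ_succ_pow_ten_le` : `F_{n+2}·21^n ≤ 2·34^n`, `F_{n+2}^10 ≤ 2^(7n+10)` (growth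
  rate `2^{0.7 n}`; the asymptotic fit at slope `7/5` needs a rate strictly between `log₂ φ ≈ 0.694` and `5/7`);
* `rec_mono`, `exists_rec_seq` : monotonicity / existence for `x_{m+2} = c_m x_{m+1} + x_m`;
* `lam_mul_b_le_pow : λ b_m ≤ λ^{F_{m+2}}`, i.e. `b_m ≤ λ^{G(m)}` ([BhargavDuttaSaxena2024, Lemma 4.1] — the half that is
  needed once the induction thresholds are `b_m/2` rather than `λ^{G(m)}/8`);
* `wronskian : b_{m+1}|c_m| + b_m|c_{m+1}| = q₀`, `q_eq : q₀ = λ p₀ + |c_1|`, `b_succ_mul_A_le`, `q_le_two_mul`;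
* `cong : p₀ b_m = P_m q₀ + (-1)^m |c_m|` ([BhargavDuttaSaxena2024, eq. (4.3)]: `p₀ b_m ≡ c_m (mod q₀)`), exact form.

The spacing law built on these (`key`/`law`/`step`) and the packaged parameters are `DepthWindowBDSLaw.lean`.
Unconditional, 0 sorry; rung currency only — nothing here bears on `VP ≠ VNP` itself.

References: [BhargavDuttaSaxena2024] §4.1, Lemma 4.1, eqs. (4.1)–(4.3) (= MFCS 2022, LIPIcs 241:18, App. A, Lemma 17);
[LimayeSrinivasanTavenas2025] Claim 16 (where the law is consumed).
-/

-- layout Summits/ValiantsHypothesis/ValiantsHypothesis forces the duplicated namespace component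
set_option linter.dupNamespace false

namespace Summit.ValiantsHypothesis.ValiantsHypothesis.Theorems.DepthWindow.BDS

open Nat

/-! ## Growth of the Fibonacci exponents -/

/-- `F_{n+2} · 21^n ≤ 2 · 34^n`: the Fibonacci numbers grow slower than `(34/21)^n < 2^{0.7 n}`
(two-step induction: `21·34 + 21² = 1155 ≤ 1156 = 34²`). -/
theorem fib_succ_succ_mul_pow_le (n : ℕ) : fib (n + 2) * 21 ^ n ≤ 2 * 34 ^ n := by
  suffices h : ∀ n, fib (n + 2) * 21 ^ n ≤ 2 * 34 ^ n ∧ fib (n + 3) * 21 ^ (n + 1) ≤ 2 * 34 ^ (n + 1) from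
    (h n).1
  intro n
  induction n with
  | zero => exact ⟨by decide, by decide⟩
  | succ n ih =>
    obtain ⟨h1, h2⟩ := ih
    have h2' : fib (n + 3) * 21 ^ (n + 1) ≤ 2 * 34 ^ (n + 1) := h2
    refine ⟨h2', ?_⟩
    show fib (n + 4) * 21 ^ (n + 2) ≤ 2 * 34 ^ (n + 2)
    have e : fib (n + 4) = fib (n + 2) + fib (n + 3) := Nat.fib_add_two
    rw [e]
    calc (fib (n + 2) + fib (n + 3)) * 21 ^ (n + 2)
        = fib (n + 2) * 21 ^ n * 441 + fib (n + 3) * 21 ^ (n + 1) * 21 := by ring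
      _ ≤ 2 * 34 ^ n * 441 + 2 * 34 ^ (n + 1) * 21 :=
          Nat.add_le_add (Nat.mul_le_mul_right _ h1) (Nat.mul_le_mul_right _ h2')
      _ = 2 * 34 ^ n * 1155 := by ring
      _ ≤ 2 * 34 ^ n * 1156 := Nat.mul_le_mul_left _ (by norm_num)
      _ = 2 * 34 ^ (n + 2) := by ring

/-- `F_{n+2}^10 ≤ 2^{7n+10}`: the exponent sequence `G(n) + 1 = F_{n+2}` grows at rate at most `2^{0.7 n}`. -/
theorem fib_succ_succ_pow_ten_le (n : ℕ) : fib (n + 2) ^ 10 ≤ 2 ^ (7 * n + 10) := by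
  have h10 : (fib (n + 2) * 21 ^ n) ^ 10 ≤ (2 * 34 ^ n) ^ 10 :=
    Nat.pow_le_pow_left (fib_succ_succ_mul_pow_le n) 10
  have h34 : (34 : ℕ) ^ 10 ≤ 2 ^ 7 * 21 ^ 10 := by norm_num
  have hrhs : (2 * 34 ^ n) ^ 10 ≤ 2 ^ (7 * n + 10) * (21 ^ n) ^ 10 := by
    have e1 : (2 * 34 ^ n) ^ 10 = 2 ^ 10 * (34 ^ 10) ^ n := by
      rw [mul_pow, ← pow_mul, ← pow_mul, mul_comm n 10]
    have e2 : 2 ^ (7 * n + 10) * (21 ^ n) ^ 10 = 2 ^ 10 * (2 ^ 7 * 21 ^ 10) ^ n := by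
      rw [mul_pow, ← pow_mul, ← pow_mul, ← pow_mul, pow_add, mul_comm n 10]
      ring
    rw [e1, e2]
    exact Nat.mul_le_mul_left _ (Nat.pow_le_pow_left h34 n)
  have hmul : fib (n + 2) ^ 10 * (21 ^ n) ^ 10 ≤ 2 ^ (7 * n + 10) * (21 ^ n) ^ 10 :=
    calc fib (n + 2) ^ 10 * (21 ^ n) ^ 10 = (fib (n + 2) * 21 ^ n) ^ 10 := by ring
      _ ≤ _ := h10.trans hrhs
  exact Nat.le_of_mul_le_mul_right hmul (by positivity)

/-! ## Three-term recursions `x_{m+2} = c_m x_{m+1} + x_m` -/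

/-- A solution of `x_{m+2} = c_m x_{m+1} + x_m` with `c_m ≥ 1` and `x_0 ≤ x_1` is monotone. -/
theorem rec_mono {c x : ℕ → ℕ} (hc : ∀ m, 1 ≤ c m) (hx : ∀ m, x (m + 2) = c m * x (m + 1) + x m)
    (h01 : x 0 ≤ x 1) : Monotone x := by
  refine monotone_nat_of_le_succ fun m => ?_
  cases m with
  | zero => exact h01
  | succ m =>
    show x (m + 1) ≤ x (m + 2)
    rw [hx]
    calc x (m + 1) ≤ c m * x (m + 1) := Nat.le_mul_of_pos_left _ (hc m)
      _ ≤ _ := Nat.le_add_right _ _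

/-- Existence of the solution of `x_{m+2} = c_m x_{m+1} + x_m` with prescribed `x_0, x_1` (a recursion on pairs; the
file stays definition-free). -/
theorem exists_rec_seq (c : ℕ → ℕ) (x0 x1 : ℕ) :
    ∃ x : ℕ → ℕ, x 0 = x0 ∧ x 1 = x1 ∧ ∀ m, x (m + 2) = c m * x (m + 1) + x m := by
  let g : ℕ → ℕ × ℕ := fun m =>
    Nat.rec (motive := fun _ => ℕ × ℕ) (x0, x1) (fun m p => (p.2, c m * p.2 + p.1)) m
  exact ⟨fun m => (g m).1, rfl, rfl, fun m => rfl⟩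

/-! ## The denominators `b` and the numerators `A` -/

/-- The denominators increase (`λ ≥ 1`, `r_m ≥ 1`). -/
theorem b_mono {lam : ℕ} {r b : ℕ → ℕ} (hlam : 1 ≤ lam) (hr : ∀ m, 1 ≤ r m) (hb0 : b 0 = 1) (hb1 : b 1 = lam)
    (hb2 : ∀ m, b (m + 2) = r (m + 1) * b (m + 1) + b m) : Monotone b :=
  rec_mono (c := fun m => r (m + 1)) (fun m => hr _) hb2 (by rw [hb0, hb1]; exact hlam)

/-- `|c_m|` decreases in `m`, i.e. `A` increases in the downward index. -/
theorem A_mono {N : ℕ} {r A : ℕ → ℕ} (hr : ∀ m, 1 ≤ r m) (hA0 : A 0 = 1) (hA1 : A 1 = 1)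
    (hA2 : ∀ i, A (i + 2) = r (N - i) * A (i + 1) + A i) : Monotone A :=
  rec_mono (c := fun i => r (N - i)) (fun i => hr _) hA2 (by rw [hA0, hA1])

/-- Half of [BhargavDuttaSaxena2024, Lemma 4.1]: `b_m ≤ λ^{G(m)}`, `G(m) = F_{m+2} - 1`, stated as `λ b_m ≤ λ^{F_{m+2}}`. -/
theorem lam_mul_b_le_pow {lam : ℕ} {r b : ℕ → ℕ} (hlam : 1 ≤ lam) (hr : ∀ m, 1 ≤ r m)
    (hrE : ∀ m, r m + 1 = lam ^ fib (m + 1)) (hb0 : b 0 = 1) (hb1 : b 1 = lam)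
    (hb2 : ∀ m, b (m + 2) = r (m + 1) * b (m + 1) + b m) : ∀ m, lam * b m ≤ lam ^ fib (m + 2) := by
  have hmono := b_mono hlam hr hb0 hb1 hb2
  suffices h : ∀ m, lam * b m ≤ lam ^ fib (m + 2) ∧ lam * b (m + 1) ≤ lam ^ fib (m + 3) from fun m => (h m).1
  intro m
  induction m with
  | zero =>
    rw [hb0, hb1, show fib 2 = 1 by decide, show fib 3 = 2 by decide, mul_one, pow_one, pow_two]
    exact ⟨le_rfl, le_rfl⟩
  | succ m ih =>
    have h2 : lam * b (m + 1) ≤ lam ^ fib (m + 3) := ih.2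
    refine ⟨h2, ?_⟩
    show lam * b (m + 2) ≤ lam ^ fib (m + 4)
    have e : fib (m + 4) = fib (m + 2) + fib (m + 3) := Nat.fib_add_two
    have hr1 : r (m + 1) + 1 = lam ^ fib (m + 2) := hrE (m + 1)
    rw [hb2, e, pow_add, ← hr1]
    calc lam * (r (m + 1) * b (m + 1) + b m)
        ≤ lam * (r (m + 1) * b (m + 1) + b (m + 1)) :=
          Nat.mul_le_mul_left _ (Nat.add_le_add_left (hmono (Nat.le_succ m)) _)
      _ = (r (m + 1) + 1) * (lam * b (m + 1)) := by ring
      _ ≤ (r (m + 1) + 1) * lam ^ fib (m + 3) := Nat.mul_le_mul_left _ h2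

/-! ## The Wronskian identity and the congruence `p₀ b_m ≡ c_m (mod q₀)` -/

/-- **Wronskian identity**: `b_{m+1}|c_m| + b_m|c_{m+1}| = b_{N+1} + b_N (= q₀)` for `m ≤ N`; in the downward index
`i = N - m`: `b_{m+1} A (i+1) + b_m A i = b_{N+1} + b_N`.  (`b` and `|c|` solve the same recursion in opposite
directions, so the Wronskian is constant; at the top it is `b_{N+1}·1 + b_N·1`.) -/
theorem wronskian {N : ℕ} {r b A : ℕ → ℕ} (hb2 : ∀ m, b (m + 2) = r (m + 1) * b (m + 1) + b m)
    (hA0 : A 0 = 1) (hA1 : A 1 = 1) (hA2 : ∀ i, A (i + 2) = r (N - i) * A (i + 1) + A i) :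
    ∀ i m : ℕ, i + m = N → b (m + 1) * A (i + 1) + b m * A i = b (N + 1) + b N := by
  intro i
  induction i with
  | zero =>
    intro m hm
    obtain rfl : m = N := by omega
    rw [hA0, hA1, mul_one, mul_one]
  | succ i ih =>
    intro m hm
    have h := ih (m + 1) (by omega)
    rw [hb2] at h
    rw [show i + 1 + 1 = i + 2 from rfl, hA2, show N - i = m + 1 by omega]
    calc b (m + 1) * (r (m + 1) * A (i + 1) + A i) + b m * A (i + 1)
        = (r (m + 1) * b (m + 1) + b m) * A (i + 1) + b (m + 1) * A i := by ring
      _ = b (N + 1) + b N := h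

/-- The source's formula for `q₀` ([BhargavDuttaSaxena2024, §4.1]): `q₀ = c_0 λ - c_1 = λ|c_0| + |c_1|`, i.e.
`b_{N+1} + b_N = λ A (N+1) + A N`. -/
theorem q_eq {lam N : ℕ} {r b A : ℕ → ℕ} (hb0 : b 0 = 1) (hb1 : b 1 = lam)
    (hb2 : ∀ m, b (m + 2) = r (m + 1) * b (m + 1) + b m)
    (hA0 : A 0 = 1) (hA1 : A 1 = 1) (hA2 : ∀ i, A (i + 2) = r (N - i) * A (i + 1) + A i) :
    b (N + 1) + b N = lam * A (N + 1) + A N := by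
  have h := wronskian hb2 hA0 hA1 hA2 N 0 (by omega)
  rw [zero_add, hb1, hb0, one_mul] at h
  exact h.symm

/-- `b_{m+1}|c_m| ≤ q₀` (`m ≤ N`). -/
theorem b_succ_mul_A_le {N m : ℕ} {r b A : ℕ → ℕ} (hb2 : ∀ m, b (m + 2) = r (m + 1) * b (m + 1) + b m)
    (hA0 : A 0 = 1) (hA1 : A 1 = 1) (hA2 : ∀ i, A (i + 2) = r (N - i) * A (i + 1) + A i) (hm : m ≤ N) :
    b (m + 1) * A (N + 1 - m) ≤ b (N + 1) + b N := by
  have h := wronskian hb2 hA0 hA1 hA2 (N - m) m (by omega)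
  rw [show N - m + 1 = N + 1 - m by omega] at h
  omega

/-- `q₀ ≤ 2 b_{m+1}|c_m|` (`m ≤ N`): the other Wronskian term is the smaller one. -/
theorem q_le_two_mul {lam N m : ℕ} {r b A : ℕ → ℕ} (hlam : 1 ≤ lam) (hr : ∀ m, 1 ≤ r m)
    (hb0 : b 0 = 1) (hb1 : b 1 = lam) (hb2 : ∀ m, b (m + 2) = r (m + 1) * b (m + 1) + b m)
    (hA0 : A 0 = 1) (hA1 : A 1 = 1) (hA2 : ∀ i, A (i + 2) = r (N - i) * A (i + 1) + A i) (hm : m ≤ N) :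
    b (N + 1) + b N ≤ 2 * (b (m + 1) * A (N + 1 - m)) := by
  have h := wronskian hb2 hA0 hA1 hA2 (N - m) m (by omega)
  have hb : b m ≤ b (m + 1) := b_mono hlam hr hb0 hb1 hb2 (Nat.le_succ m)
  have ha : A (N - m) ≤ A (N - m + 1) := A_mono hr hA0 hA1 hA2 (Nat.le_succ (N - m))
  rw [show N - m + 1 = N + 1 - m by omega] at h ha
  nlinarith

/-- **The congruence** [BhargavDuttaSaxena2024, eq. (4.3)] in exact form: `p₀ b_m = P_m q₀ + c_m` with
`c_m = (-1)^m |c_m|`, for `0 ≤ m ≤ N + 1`. -/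
theorem cong {lam N : ℕ} {r b A P : ℕ → ℕ} (hb0 : b 0 = 1) (hb1 : b 1 = lam)
    (hb2 : ∀ m, b (m + 2) = r (m + 1) * b (m + 1) + b m)
    (hA0 : A 0 = 1) (hA1 : A 1 = 1) (hA2 : ∀ i, A (i + 2) = r (N - i) * A (i + 1) + A i)
    (hP0 : P 0 = 0) (hP1 : P 1 = 1) (hP2 : ∀ m, P (m + 2) = r (m + 1) * P (m + 1) + P m)
    {m : ℕ} (hm : m ≤ N + 1) :
    (A (N + 1) : ℤ) * b m = P m * (b (N + 1) + b N : ℕ) + (-1) ^ m * A (N + 1 - m) := by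
  have hq := q_eq hb0 hb1 hb2 hA0 hA1 hA2
  -- pairs of consecutive instances, by induction
  suffices h : ∀ m, m ≤ N →
      ((A (N + 1) : ℤ) * b m = P m * (b (N + 1) + b N : ℕ) + (-1) ^ m * A (N + 1 - m)) ∧
      ((A (N + 1) : ℤ) * b (m + 1) = P (m + 1) * (b (N + 1) + b N : ℕ) + (-1) ^ (m + 1) * A (N + 1 - (m + 1))) by
    rcases Nat.eq_zero_or_pos m with rfl | hpos
    · exact (h 0 (Nat.zero_le N)).1
    · obtain ⟨m', rfl⟩ : ∃ m', m = m' + 1 := ⟨m - 1, by omega⟩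
      exact (h m' (by omega)).2
  intro m
  induction m with
  | zero =>
    intro _
    refine ⟨by simp [hb0, hP0], ?_⟩
    rw [zero_add, hb1, hP1, hq, show N + 1 - 1 = N from rfl]
    push_cast
    ring
  | succ m ih =>
    intro hm1
    obtain ⟨h0, h1⟩ := ih (by omega)
    refine ⟨h1, ?_⟩
    rw [show N + 1 - m = (N - 1 - m) + 2 by omega, hA2, show N - (N - 1 - m) = m + 1 by omega,
      show N - 1 - m + 1 = N - m by omega] at h0
    rw [show N + 1 - (m + 1) = N - m by omega] at h1
    rw [hb2, hP2, show N + 1 - (m + 1 + 1) = N - 1 - m by omega]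
    push_cast at h0 h1 ⊢
    linear_combination (r (m + 1) : ℤ) * h1 + h0

end Summit.ValiantsHypothesis.ValiantsHypothesis.Theorems.DepthWindow.BDS
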